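import Mathlib
import Literature.MathematicalPhysics.QuantumFieldTheory.Balaban1983to89.B10Eq17LocalSolution
import Literature.MathematicalPhysics.QuantumFieldTheory.Balaban1983to89.B13CorridorSeparation
import Literature.MathematicalPhysics.QuantumFieldTheory.Balaban1983to89.B13QuadAnalyticFrechet
import HarnessLib

/-!
# `Balaban1983to89.B10Eq17LocalTorus` — T. Bałaban, *Ultraviolet stability of three-dimensional lattice pure gauge
field theories*, Commun. Math. Phys. **102** (1985) 255–275 [Balaban1985UV3], (17) p. 260 and (20) p. 261 for THE
LOCAL solution `D̃` ON THE TORUS: the geometric hypotheses `hb` / `hsep` of `B10Eq17LocalSolution` §4–§5 discharged by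
name on the periodic block geometry of `B16TstarCount` / `B13CorridorSeparation`, and the p. 260 paragraph end to end
(existence, local uniqueness, analyticity, dependence on `A↾B(c₋) ∪ B(c₊)`, and the block Jacobian (20) with the
ACTUAL Fréchet derivative) from print-admissible data only

statement-level skeleton of published theorems with citation tags; proofs where landed; nothing here is a claim about
the Yang–Mills mass gap

PDF held: `paper:balaban1985-cmp102-uv-stability-3d` (journal page = PDF page + 254); p. 260 = `p0006.txt`, p. 261 =
`p0007.txt`; renders `run/shared/lean/pub/pub-balaban/b2b-balaban-ref1/pages/1985-cmp102-uv-stability-3d/…-p006-x2.png`,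
`…-p007-x2.png`.

CITATION HEADER.  WHAT IS REPRODUCED: SKELETON rows `B10.Eq17` / `B10.Eq20` of the mega-formalization `lit-balaban`
(`run/shared/lean/pub/lit-balaban/SKELETON.md` §B10; NE-spine interface `INTERFACES.md` §1.3 row `B10.Eq17-18`,
F-T4-150), on the concrete periodic lattice.  The print, p. 260 [PDF 6], verbatim (quoted in full in the headers of
`B10Eq17LocalSolution` and `B13CorridorSeparation`): *«QD̃(A, c) = C(A − D̃(A, c), c). Let us denote by b₀(c) the
bond b ∈ B(c) and contained in c (let us recall that B(c) is the set of bonds connecting the blocks B(c₋), B(c₊) …).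
We assume that D̃(A, b, c) = 0 for all b ≠ b₀(c). This assures the locality properties. … There exists a unique
solution D̃ of this equation for A sufficiently small, and it is an analytic function of A with a Taylor expansion
beginning with second order terms. The function D̃(A, c), similarly as Q(A′, c), depends on A restricted to
B(c₋) ∪ B(c₊).»*; p. 261 [PDF 7], (20): *«exp Tr log(I − (δ/δA)D̃(A)) = exp[Σ_{c∈Ω₁^{(1)}} tr log(1 −
(∂/∂A(b₀(c)))D̃(A, b₀(c), c))]»*.

WHAT THIS MODULE DOES (unit `lit-balaban-r07`, gen 9; B10 fold owner).  `B10Eq17LocalSolution` (p254876 / p255269)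
re-typed (17) print-faithfully as the LOCAL statement `Eq17Local 𝕜 b₀ h C̃ r δ Dt`, PROVED it for every admissible
`(C̃, h)` over `ℂ` (`exists_eq17Local`) and over `ℝ` (`exists_eq17Local_real`), and derived from it the p. 260
dependence sentence (`Eq17Local.apply_eq_of_eqOn`) and (20) (`Eq17Local.eq20`, `Eq17Local.eq20_exp_sum_log`) —
over an ABSTRACT coarse map `b₀ : C → β` with dependence sets `N : C → Set β`, under the two geometric hypotheses
`hb : Function.Injective b₀` and `hsep : ∀ c c′, c ≠ c′ → b₀ c′ ∉ N c`.  The cell's `B13CorridorSeparation` §2/§4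
PROVED both on the torus of `B16TstarCount` §2 (fine lattice `(ℤ/n)ᵈ`, coarse `(ℤ/m)ᵈ`, `n = L·m`, blocks of offset
`h < L`, the printed corridor bond `b0 L n h c`, dependence set `depSet … c` = the bonds `⊂ B(c₋) ∪ B(c₊)`; the
separation needs `2 < m`, sharp by `torus_not_separated_two`) — but re-exported there only the GLOBAL-uniqueness
forms `fixedPt_fpMap_apply_eq_torus` / `eq20_of_fixedPt_torus`, whose inputs `hfix`/`huniq` (a fixed point for
EVERY `A`, unique among ALL `D`) are unsatisfiable for print-admissible data (`B10Eq17LocalSolution.not_eq17_sqCt`).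
Here the LOCAL forms are put on the torus:

* §0 `hasFDerivAt_Dt` / `hasFDerivAt_hOp_Dt` / `differentiableAt_hOp_Dt` — from `Eq17Local`: `D̃` and `A ↦ hD̃(A)`
  are Fréchet differentiable at every point of the ball «A sufficiently small» (analyticity clause + the sup-norm
  bound `‖hD‖ ≤ b‖D‖` of `B10Eq17LocalSolution.norm_hOpLin_le`), so the `(δ/δA)hD̃(A)` of (20) EXISTS there.
* §1 `apply_eq_of_eqOn_torus` — p. 260 «D̃(A, c) … depends on A restricted to B(c₋) ∪ B(c₊)» for the `Eq17Local`
  solution on the torus (`2 < m`): `B`, `B′` in the ball agreeing on `depSet c` ⇒ `Dt B c = Dt B′ c`;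
  `eq20_torus` / `eq20_exp_sum_log_torus` — (20) on the torus for the `Eq17Local` solution and any Fréchet
  derivative `L` of `A ↦ hD̃(A)` at a point of the ball; `eq20_fderiv_torus` — the same with `L` = THE derivative
  `fderiv 𝕜 (A ↦ hD̃(A)) A` (no `hL` binder left).
* §2 END TO END, binders = print's data only.  `exists_local_solution_torus` (`ℂ`; coordinates `X = ι → ℂ` of `𝔤ᶜ`):
  for `C̃` with the printed quadratic bound + analyticity (`B13Contraction113.QuadAnalytic C̃ C₂ R`,
  `AnalyticOnNhd` on `‖Y‖ < R`) and local in the variables on `B(c₋) ∪ B(c₊)` ([B7] Prop. 4 shape `hCt`), `h(c)`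
  linear with `‖h c x‖ ≤ b‖x‖`, and `0 < ε`, `9C₂bε < 1`, `3ε ≤ R`: there is `Dt` with
  `Eq17Local ℂ (b0 L n h) h C̃ ε (4C₂ε²) Dt`, the dependence property on the ball, and (20) with the actual
  derivative at every `‖A‖ < ε`.  `exists_local_solution_torus_real` (`ℝ`; `X = ι → ℝ`): the same from `C̃`
  real-analytic near `0` with `C̃(0) = 0`, `DC̃(0) = 0`, for some radii `r, δ > 0`.

SCOPE, stated honestly.  Everything is a one-line knit of landed theorems (`B10Eq17LocalSolution` §2/§4/§5/§6 with
`B13CorridorSeparation.torus_b0_injective` / `torus_b0_not_mem_depSet_of_ne`); the geometry readings (bonds indexed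
(initial point, direction); «b ⊂ B(c₋) ∪ B(c₊)» = both endpoints in the two blocks; offset-`h` blocks) are those of
`B16TstarCount` / `B13CorridorSeparation` and are not re-argued.  The `ℤᵈ` companions of `B13CorridorSeparation` §4
have no local analogue here: `Eq17Local` lives on finite bond sets (sup norms on `β → X`), as does B10 itself (the
torus `T`).  Which concrete `Q(A′, c)` of (14)–(15) has which dependence set / quadratic constant is [6] Sect. E /
[7] Prop. 4 business (rows `B8.Eq1.125`, `B11.Prop4`), fed through the binders `hC`, `hCa`, `hCt`; nothing of
[Balaban1985UV3] beyond these finite-dimensional statements is asserted.  Rows in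
`run/shared/lean/pub/lit-balaban/lit-balaban-r07/ROWS-B10.md`.

REVISION v1.1 (gen 10; every v1 declaration byte-identical, additions only: one `import` and the new §3).  The
binder `hCa : AnalyticOnNhd ℂ C̃ {Y | ‖Y‖ < R}` displayed next to `hC : QuadAnalytic C̃ C₂ R` in §2 and in
`B10Eq17LocalSolution.exists_solution` is REDUNDANT: the cell's `B13QuadAnalyticFrechet.analyticOnNhd_of_quadAnalytic`
(seat p24 gen 6, p255778; Graves–Taylor–Hille–Zorn + [Chae1985] Thm 14.13, `Literature.Analysis.Complex.HolomorphicBanach`)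
derives it from `hC` on any complex normed carrier.  That file imports `B10Eq17LocalSolution`, so the `hCa`-free forms
cannot be appended there; they are appended HERE: §3 `exists_solution_of_quadAnalytic` (= `exists_solution` with its
[7] p. 286 uniqueness clause among `‖hD‖ < ε`, `hCa` discharged), `exists_local_solution_torus_of_quadAnalytic`
(= §2 `exists_local_solution_torus`, `hCa` discharged) and the radius form `exists_radius_local_solution_torus`
(«for A sufficiently small»: some `ε > 0`, given `R > 0`).  After v1.1 the binders of the complex torus statement are
exactly print's data: the quadratic-bound/analyticity structure of `C̃` ([7] Prop. 4 shape), its locality on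
`B(c₋) ∪ B(c₊)`, the norm bound of the linear `h(c)`, and the three numerical side conditions of [7] Sect. C.

REVISION v1.2 (gen 13; every v1.1 declaration byte-identical, additions only: the new §4).  The REAL torus statement of
§2 (`exists_local_solution_torus_real`) lacked the uniqueness clause in print's own solution space that the complex one
carries since v1/v1.1 ([7] p. 286 «exactly one fixed point … |D(A′)| < ε₃/B₀»); `B10Eq17LocalSolution` v1.2 §7
(p303399: `exists_solution_real`, `existsUnique_solution_real`) supplies it, and §4 knits it onto the torus:
`exists_local_solution_torus_real_unique` (§2's real statement + `‖hD̃(A)‖ < 3r` + uniqueness among `‖hD‖ < 3r`) and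
`existsUnique_local_solution_torus_real` (the `∃!` form of «a unique solution … for A sufficiently small»).
-/

open Metric Set Filter Topology
open scoped ContDiff

namespace Literature.MathematicalPhysics.QuantumFieldTheory.Balaban1983to89.B10Eq17LocalTorus

open B16TstarCount (Bond blk fUnit cUnit b0)
open B13CorridorSeparation (depSet torus_b0_injective torus_b0_not_mem_depSet_of_ne)
open B13PkLocalTerms (hOp fpMap)
open B13Contraction113 (QuadAnalytic)
open B10Eq17LocalSolution
open B10Eq20Locality (coarseBlock jac)

/-! ## §0  From `Eq17Local`: the Jacobian `(δ/δA)hD̃(A)` of (20) exists on the ball -/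

section Jacobian

variable {𝕜 : Type*} [NontriviallyNormedField 𝕜] {β C X : Type*} [Fintype β] [Fintype C]
  [NormedAddCommGroup X] [NormedSpace 𝕜 X] {b₀ : C → β} {Ct : (β → X) → C → X} {r δ : ℝ}
  {Dt : (β → X) → C → X}

/-- From the analyticity clause of `Eq17Local`: `D̃` is Fréchet differentiable at every point of the ball
`‖A‖ < r` («it is an analytic function of A»). [cite: Balaban1985UV3, (17) p.260] -/
theorem hasFDerivAt_Dt {h : C → X → X} (h17 : Eq17Local 𝕜 b₀ h Ct r δ Dt) {A : β → X} (hA : ‖A‖ < r) :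
    HasFDerivAt Dt (fderiv 𝕜 Dt A) A :=
  (h17.2.2.2.1.differentiableOn.differentiableAt
    (isOpen_ball.mem_nhds (mem_ball_zero_iff.mpr hA))).hasFDerivAt

/-- `A ↦ hD̃(A)` (the map whose Jacobian enters (20)) is Fréchet differentiable at every point of the ball, with
derivative `h ∘ DD̃(A)` — `h` made continuous by the sup-norm bound `‖hD‖ ≤ b‖D‖`
(`B10Eq17LocalSolution.norm_hOpLin_le`). [cite: Balaban1985UV3, (20) p.261] -/
theorem hasFDerivAt_hOp_Dt {h : C → X →ₗ[𝕜] X} (h17 : Eq17Local 𝕜 b₀ (fun c => ⇑(h c)) Ct r δ Dt) {b : ℝ}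
    (hb : 0 ≤ b) (hh : ∀ c x, ‖h c x‖ ≤ b * ‖x‖) {A : β → X} (hA : ‖A‖ < r) :
    HasFDerivAt (fun A => hOp b₀ (fun c => ⇑(h c)) (Dt A))
      (((hOpLin b₀ h).mkContinuous b (norm_hOpLin_le b₀ h hb hh)).comp (fderiv 𝕜 Dt A)) A :=
  ((hOpLin b₀ h).mkContinuous b (norm_hOpLin_le b₀ h hb hh)).hasFDerivAt.comp A (hasFDerivAt_Dt h17 hA)

/-- Hence `A ↦ hD̃(A)` is differentiable at every point of the ball and `fderiv` is its Jacobian there.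
[cite: Balaban1985UV3, (20) p.261] -/
theorem differentiableAt_hOp_Dt {h : C → X →ₗ[𝕜] X} (h17 : Eq17Local 𝕜 b₀ (fun c => ⇑(h c)) Ct r δ Dt) {b : ℝ}
    (hb : 0 ≤ b) (hh : ∀ c x, ‖h c x‖ ≤ b * ‖x‖) {A : β → X} (hA : ‖A‖ < r) :
    DifferentiableAt 𝕜 (fun A => hOp b₀ (fun c => ⇑(h c)) (Dt A)) A :=
  (hasFDerivAt_hOp_Dt h17 hb hh hA).differentiableAt

end Jacobian

/-! ## §1  The local theorems of `B10Eq17LocalSolution` §4–§5 on the torus (`hb`, `hsep` discharged) -/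

section Torus

variable {𝕜 : Type*} [NontriviallyNormedField 𝕜] {d n m : ℕ} [NeZero m] [NeZero n]
  {X : Type*} [NormedAddCommGroup X] [NormedSpace 𝕜 X]

/-- **[B10] p. 260 «The function D̃(A, c) … depends on A restricted to B(c₋) ∪ B(c₊)» on the torus, for THE LOCAL
solution** (`B10Eq17LocalSolution.Eq17Local.apply_eq_of_eqOn` with `hb`, `hsep` discharged by
`B13CorridorSeparation.torus_b0_injective` / `torus_b0_not_mem_depSet_of_ne`, `2 < m` coarse sites per direction):
if `C̃(A)(c)` depends on `A` only on the bonds of `B(c₋) ∪ B(c₊)` (`depSet c`) and `Dt` is the `Eq17Local` solution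
of (17) on `‖B‖ < r`, then `Dt B c = Dt B′ c` whenever `B`, `B′` lie in the ball and agree on `depSet c`.  (The cell's
`B13CorridorSeparation.fixedPt_fpMap_apply_eq_torus` is the same conclusion from GLOBAL existence/uniqueness.)
[cite: Balaban1985UV3, (17) p.260] -/
theorem apply_eq_of_eqOn_torus (L h : ℕ) (hn : n = L * m) (hh : h < L) (hm : 2 < m)
    {hop : Bond (Fin d → ZMod m) d → X → X}
    {Ct : (Bond (Fin d → ZMod n) d → X) → Bond (Fin d → ZMod m) d → X}
    (hCt : ∀ A A' c, (∀ b ∈ depSet (blk (n := n) L m h) (fUnit n) (cUnit m) c, A b = A' b) → Ct A c = Ct A' c)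
    {r δ : ℝ} {Dt : (Bond (Fin d → ZMod n) d → X) → Bond (Fin d → ZMod m) d → X}
    (h17 : Eq17Local 𝕜 (b0 L n h) hop Ct r δ Dt)
    {B B' : Bond (Fin d → ZMod n) d → X} (hB : ‖B‖ < r) (hB' : ‖B'‖ < r) {c : Bond (Fin d → ZMod m) d}
    (hBB' : ∀ b ∈ depSet (blk (n := n) L m h) (fUnit n) (cUnit m) c, B b = B' b) : Dt B c = Dt B' c :=
  h17.apply_eq_of_eqOn (torus_b0_injective L h hn hh) (torus_b0_not_mem_depSet_of_ne L h hn hh hm) hCt hB hB' hBB'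

/-- **[B10] (20) p. 261 on the torus for THE LOCAL solution of (17)** (`B10Eq17LocalSolution.Eq17Local.eq20` with
`hb`, `hsep` discharged): in coordinates `X = ι → 𝕜`, with `C̃` local on `B(c₋) ∪ B(c₊)`, `Dt` the `Eq17Local`
solution on `‖A‖ < r`, and `L` a Fréchet derivative of `A ↦ hD̃(A)` at a point `A` of the ball:
`det(I − L) = Π_c det(1 − J_c)`, `J_c` the `ι × ι` block of `L` at `b₀(c)`.  (The cell's
`B13CorridorSeparation.eq20_of_fixedPt_torus` needs the global pair `hfix`/`huniq`.) [cite: Balaban1985UV3, (20) p.261] -/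
theorem eq20_torus {ι : Type*} [Fintype ι] [DecidableEq ι] (L h : ℕ) (hn : n = L * m) (hh : h < L) (hm : 2 < m)
    {hop : Bond (Fin d → ZMod m) d → (ι → 𝕜) → (ι → 𝕜)}
    {Ct : (Bond (Fin d → ZMod n) d → ι → 𝕜) → Bond (Fin d → ZMod m) d → (ι → 𝕜)}
    (hCt : ∀ A A' c, (∀ b ∈ depSet (blk (n := n) L m h) (fUnit n) (cUnit m) c, A b = A' b) → Ct A c = Ct A' c)
    {r δ : ℝ} {Dt : (Bond (Fin d → ZMod n) d → ι → 𝕜) → Bond (Fin d → ZMod m) d → (ι → 𝕜)}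
    (h17 : Eq17Local 𝕜 (b0 L n h) hop Ct r δ Dt)
    {A : Bond (Fin d → ZMod n) d → ι → 𝕜} (hA : ‖A‖ < r)
    {Lop : (Bond (Fin d → ZMod n) d → ι → 𝕜) →L[𝕜] (Bond (Fin d → ZMod n) d → ι → 𝕜)}
    (hL : HasFDerivAt (fun A => hOp (b0 L n h) hop (Dt A)) Lop A) :
    LinearMap.det (LinearMap.id -
        (Lop : (Bond (Fin d → ZMod n) d → ι → 𝕜) →ₗ[𝕜] (Bond (Fin d → ZMod n) d → ι → 𝕜)))
      = ∏ c, (1 - coarseBlock (b0 (m := m) L n h)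
          (jac (Lop : (Bond (Fin d → ZMod n) d → ι → 𝕜) →ₗ[𝕜] (Bond (Fin d → ZMod n) d → ι → 𝕜))) c).det :=
  h17.eq20 (torus_b0_injective L h hn hh) (torus_b0_not_mem_depSet_of_ne L h hn hh hm) hCt hA hL

/-- **(20) on the torus with `L` = THE Jacobian** `fderiv 𝕜 (A ↦ hD̃(A)) A` of the local solution (it exists by
`differentiableAt_hOp_Dt`), for linear `h(c)` with `‖h c x‖ ≤ b‖x‖`: no derivative binder is left.
[cite: Balaban1985UV3, (20) p.261] -/
theorem eq20_fderiv_torus {ι : Type*} [Fintype ι] [DecidableEq ι] (L h : ℕ) (hn : n = L * m) (hh : h < L)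
    (hm : 2 < m) {hop : Bond (Fin d → ZMod m) d → (ι → 𝕜) →ₗ[𝕜] (ι → 𝕜)}
    {Ct : (Bond (Fin d → ZMod n) d → ι → 𝕜) → Bond (Fin d → ZMod m) d → (ι → 𝕜)}
    (hCt : ∀ A A' c, (∀ b ∈ depSet (blk (n := n) L m h) (fUnit n) (cUnit m) c, A b = A' b) → Ct A c = Ct A' c)
    {b : ℝ} (hb : 0 ≤ b) (hhb : ∀ c x, ‖hop c x‖ ≤ b * ‖x‖)
    {r δ : ℝ} {Dt : (Bond (Fin d → ZMod n) d → ι → 𝕜) → Bond (Fin d → ZMod m) d → (ι → 𝕜)}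
    (h17 : Eq17Local 𝕜 (b0 L n h) (fun c => ⇑(hop c)) Ct r δ Dt)
    {A : Bond (Fin d → ZMod n) d → ι → 𝕜} (hA : ‖A‖ < r) :
    LinearMap.det (LinearMap.id -
        (fderiv 𝕜 (fun A => hOp (b0 L n h) (fun c => ⇑(hop c)) (Dt A)) A :
          (Bond (Fin d → ZMod n) d → ι → 𝕜) →ₗ[𝕜] (Bond (Fin d → ZMod n) d → ι → 𝕜)))
      = ∏ c, (1 - coarseBlock (b0 (m := m) L n h)
          (jac (fderiv 𝕜 (fun A => hOp (b0 L n h) (fun c => ⇑(hop c)) (Dt A)) A :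
            (Bond (Fin d → ZMod n) d → ι → 𝕜) →ₗ[𝕜] (Bond (Fin d → ZMod n) d → ι → 𝕜))) c).det :=
  eq20_torus L h hn hh hm hCt h17 hA (differentiableAt_hOp_Dt h17 hb hhb hA).hasFDerivAt

/-- **(20) as printed, inside `exp`, on the torus over `ℂ`** for the local solution, whenever every block determinant
is non-zero (`B10Eq17LocalSolution.Eq17Local.eq20_exp_sum_log` with `hb`, `hsep` discharged).
[cite: Balaban1985UV3, (20) p.261] -/
theorem eq20_exp_sum_log_torus {ι : Type*} [Fintype ι] [DecidableEq ι] (L h : ℕ) (hn : n = L * m) (hh : h < L)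
    (hm : 2 < m) {hop : Bond (Fin d → ZMod m) d → (ι → ℂ) → (ι → ℂ)}
    {Ct : (Bond (Fin d → ZMod n) d → ι → ℂ) → Bond (Fin d → ZMod m) d → (ι → ℂ)}
    (hCt : ∀ A A' c, (∀ b ∈ depSet (blk (n := n) L m h) (fUnit n) (cUnit m) c, A b = A' b) → Ct A c = Ct A' c)
    {r δ : ℝ} {Dt : (Bond (Fin d → ZMod n) d → ι → ℂ) → Bond (Fin d → ZMod m) d → (ι → ℂ)}
    (h17 : Eq17Local ℂ (b0 L n h) hop Ct r δ Dt)
    {A : Bond (Fin d → ZMod n) d → ι → ℂ} (hA : ‖A‖ < r)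
    {Lop : (Bond (Fin d → ZMod n) d → ι → ℂ) →L[ℂ] (Bond (Fin d → ZMod n) d → ι → ℂ)}
    (hL : HasFDerivAt (fun A => hOp (b0 L n h) hop (Dt A)) Lop A)
    (hJ : ∀ c, (1 - coarseBlock (b0 (m := m) L n h)
      (jac (Lop : (Bond (Fin d → ZMod n) d → ι → ℂ) →ₗ[ℂ] (Bond (Fin d → ZMod n) d → ι → ℂ))) c).det ≠ 0) :
    LinearMap.det (LinearMap.id -
        (Lop : (Bond (Fin d → ZMod n) d → ι → ℂ) →ₗ[ℂ] (Bond (Fin d → ZMod n) d → ι → ℂ)))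
      = Complex.exp (∑ c, Complex.log (1 - coarseBlock (b0 (m := m) L n h)
          (jac (Lop : (Bond (Fin d → ZMod n) d → ι → ℂ) →ₗ[ℂ] (Bond (Fin d → ZMod n) d → ι → ℂ))) c).det) :=
  h17.eq20_exp_sum_log (torus_b0_injective L h hn hh) (torus_b0_not_mem_depSet_of_ne L h hn hh hm) hCt hA hL hJ

end Torus

/-! ## §2  The p. 260 paragraph END TO END on the torus: binders = print's data `(C̃, h)` only -/

section EndToEnd

variable {d n m : ℕ} [NeZero m] [NeZero n] {ι : Type*} [Fintype ι] [DecidableEq ι]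

/-- **p. 260 (17) + «depends on A restricted to B(c₋) ∪ B(c₊)» + (20) p. 261, on the torus over `ℂ`, from print's
data only.**  Coordinates `X = ι → ℂ` of `𝔤ᶜ`; fine lattice `(ℤ/n)ᵈ`, coarse `(ℤ/m)ᵈ`, `n = L·m`, block offset
`h < L`, `2 < m`.  If `C̃` obeys the printed quadratic bound and analyticity on `‖Y‖ < R`
(`B13Contraction113.QuadAnalytic C̃ C₂ R`, `AnalyticOnNhd`), `C̃(·)(c)` depends only on the variables on
`B(c₋) ∪ B(c₊)` ([B7] Prop. 4), the `h(c)` are linear with `‖h c x‖ ≤ b‖x‖`, and `0 < ε`, `9C₂bε < 1`, `3ε ≤ R`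
([7] Sect. C contraction condition), then there is `Dt` with: (i) `Eq17Local ℂ b₀ h C̃ ε (4C₂ε²) Dt` — «There exists
a unique solution D̃ of this equation for A sufficiently small, and it is an analytic function of A with a Taylor
expansion beginning with second order terms»; (ii) for `B`, `B′` in the ball agreeing on `B(c₋) ∪ B(c₊)`,
`Dt B c = Dt B′ c` — «The function D̃(A, c) … depends on A restricted to B(c₋) ∪ B(c₊)»; (iii) for every `‖A‖ < ε`,
`det(I − (δ/δA)hD̃(A)) = Π_c det(1 − J_c)` with THE Fréchet derivative — (20).  Knit of
`B10Eq17LocalSolution.exists_eq17Local` with §1. [cite: Balaban1985UV3, (17)-(20) pp.260-261] -/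
theorem exists_local_solution_torus (L h : ℕ) (hn : n = L * m) (hh : h < L) (hm : 2 < m)
    (hop : Bond (Fin d → ZMod m) d → (ι → ℂ) →ₗ[ℂ] (ι → ℂ))
    {Ct : (Bond (Fin d → ZMod n) d → ι → ℂ) → Bond (Fin d → ZMod m) d → (ι → ℂ)} {C₂ R b ε : ℝ}
    (hC : QuadAnalytic Ct C₂ R) (hCa : AnalyticOnNhd ℂ Ct {Y | ‖Y‖ < R}) (hC₂ : 0 ≤ C₂) (hb : 0 ≤ b)
    (hhb : ∀ c x, ‖hop c x‖ ≤ b * ‖x‖) (hε : 0 < ε) (hq : 9 * C₂ * b * ε < 1) (hRC : 3 * ε ≤ R)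
    (hCt : ∀ A A' c, (∀ b ∈ depSet (blk (n := n) L m h) (fUnit n) (cUnit m) c, A b = A' b) → Ct A c = Ct A' c) :
    ∃ Dt : (Bond (Fin d → ZMod n) d → ι → ℂ) → Bond (Fin d → ZMod m) d → (ι → ℂ),
      Eq17Local ℂ (b0 L n h) (fun c => ⇑(hop c)) Ct ε (4 * C₂ * ε ^ 2) Dt ∧
      (∀ B B' : Bond (Fin d → ZMod n) d → ι → ℂ, ‖B‖ < ε → ‖B'‖ < ε → ∀ c : Bond (Fin d → ZMod m) d,
        (∀ b ∈ depSet (blk (n := n) L m h) (fUnit n) (cUnit m) c, B b = B' b) → Dt B c = Dt B' c) ∧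
      ∀ A : Bond (Fin d → ZMod n) d → ι → ℂ, ‖A‖ < ε →
        LinearMap.det (LinearMap.id -
            (fderiv ℂ (fun A => hOp (b0 L n h) (fun c => ⇑(hop c)) (Dt A)) A :
              (Bond (Fin d → ZMod n) d → ι → ℂ) →ₗ[ℂ] (Bond (Fin d → ZMod n) d → ι → ℂ)))
          = ∏ c, (1 - coarseBlock (b0 (m := m) L n h)
              (jac (fderiv ℂ (fun A => hOp (b0 L n h) (fun c => ⇑(hop c)) (Dt A)) A :
                (Bond (Fin d → ZMod n) d → ι → ℂ) →ₗ[ℂ] (Bond (Fin d → ZMod n) d → ι → ℂ))) c).det := by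
  obtain ⟨Dt, h17⟩ := exists_eq17Local (b0 L n h) hop hC hCa hC₂ hb hhb hε hq hRC
  exact ⟨Dt, h17, fun B B' hB hB' c hBB' => apply_eq_of_eqOn_torus L h hn hh hm hCt h17 hB hB' hBB',
    fun A hA => eq20_fderiv_torus L h hn hh hm hCt hb hhb h17 hA⟩

/-- **The same over `ℝ`, print's own setting** (`X = ι → ℝ`, coordinates of `𝔤`): if `C̃` is real-analytic (`C^ω`)
on a ball `‖Y‖ < R` around `0` with `C̃(0) = 0`, `DC̃(0) = 0`, local on `B(c₋) ∪ B(c₊)`, and `h(c)` linear with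
`‖h c x‖ ≤ b‖x‖`, then for some radii `r > 0`, `δ > 0` there is `Dt` with `Eq17Local ℝ b₀ h C̃ r δ Dt`, the dependence
property on the ball `‖·‖ < r`, and (20) with the actual derivative at every `‖A‖ < r`.  Knit of
`B10Eq17LocalSolution.exists_eq17Local_real` with §1. [cite: Balaban1985UV3, (17)-(20) pp.260-261] -/
theorem exists_local_solution_torus_real (L h : ℕ) (hn : n = L * m) (hh : h < L) (hm : 2 < m)
    (hop : Bond (Fin d → ZMod m) d → (ι → ℝ) →ₗ[ℝ] (ι → ℝ))
    {Ct : (Bond (Fin d → ZMod n) d → ι → ℝ) → Bond (Fin d → ZMod m) d → (ι → ℝ)} {R b : ℝ}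
    (hR : 0 < R) (hCω : ContDiffOn ℝ ω Ct (ball 0 R)) (hC0 : Ct 0 = 0) (hDC0 : fderiv ℝ Ct 0 = 0)
    (hb : 0 ≤ b) (hhb : ∀ c x, ‖hop c x‖ ≤ b * ‖x‖)
    (hCt : ∀ A A' c, (∀ b ∈ depSet (blk (n := n) L m h) (fUnit n) (cUnit m) c, A b = A' b) → Ct A c = Ct A' c) :
    ∃ r δ : ℝ, 0 < δ ∧ ∃ Dt : (Bond (Fin d → ZMod n) d → ι → ℝ) → Bond (Fin d → ZMod m) d → (ι → ℝ),
      Eq17Local ℝ (b0 L n h) (fun c => ⇑(hop c)) Ct r δ Dt ∧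
      (∀ B B' : Bond (Fin d → ZMod n) d → ι → ℝ, ‖B‖ < r → ‖B'‖ < r → ∀ c : Bond (Fin d → ZMod m) d,
        (∀ b ∈ depSet (blk (n := n) L m h) (fUnit n) (cUnit m) c, B b = B' b) → Dt B c = Dt B' c) ∧
      ∀ A : Bond (Fin d → ZMod n) d → ι → ℝ, ‖A‖ < r →
        LinearMap.det (LinearMap.id -
            (fderiv ℝ (fun A => hOp (b0 L n h) (fun c => ⇑(hop c)) (Dt A)) A :
              (Bond (Fin d → ZMod n) d → ι → ℝ) →ₗ[ℝ] (Bond (Fin d → ZMod n) d → ι → ℝ)))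
          = ∏ c, (1 - coarseBlock (b0 (m := m) L n h)
              (jac (fderiv ℝ (fun A => hOp (b0 L n h) (fun c => ⇑(hop c)) (Dt A)) A :
                (Bond (Fin d → ZMod n) d → ι → ℝ) →ₗ[ℝ] (Bond (Fin d → ZMod n) d → ι → ℝ))) c).det := by
  obtain ⟨r, δ, hδ, Dt, h17⟩ := exists_eq17Local_real (b0 L n h) hop hR hCω hC0 hDC0 hb hhb
  exact ⟨r, δ, hδ, Dt, h17, fun B B' hB hB' c hBB' => apply_eq_of_eqOn_torus L h hn hh hm hCt h17 hB hB' hBB',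
    fun A hA => eq20_fderiv_torus L h hn hh hm hCt hb hhb h17 hA⟩

end EndToEnd


/-! ## §3  (v1.1) The analyticity binder `hCa` discharged (`B13QuadAnalyticFrechet`, p255778) -/

section QuadAnalyticOnly

open B13QuadAnalyticFrechet (analyticOnNhd_of_quadAnalytic)

variable {X : Type*} [NormedAddCommGroup X] [NormedSpace ℂ X] [CompleteSpace X]
  {β C : Type*} [Fintype β] [Fintype C]

/-- **`B10Eq17LocalSolution.exists_solution` from `QuadAnalytic C̃ C₂ R` and the norm bound on `h` ALONE**: «There
exists a unique solution D̃ of this equation for A sufficiently small, and it is an analytic function of A with a Taylor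
expansion beginning with second order terms» in the local reading `Eq17Local ℂ b₀ h C̃ ε (4C₂ε²) Dt`, together with the
uniqueness clause in print's own solution space ([7] p. 286): for `‖A‖ < ε` every fixed point `D` of
`D ↦ C̃(A − hD)` with `‖hD‖ < ε` equals `Dt A`.  The binder `hCa` of `exists_solution` is supplied by
`B13QuadAnalyticFrechet.analyticOnNhd_of_quadAnalytic hC`. [cite: Balaban1985UV3, (17) pp.259–260] -/
theorem exists_solution_of_quadAnalytic (b₀ : C → β) (h : C → X →ₗ[ℂ] X) {Ct : (β → X) → C → X}
    {C₂ R b ε : ℝ} (hC : QuadAnalytic Ct C₂ R) (hC₂ : 0 ≤ C₂) (hb : 0 ≤ b)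
    (hh : ∀ c x, ‖h c x‖ ≤ b * ‖x‖) (hε : 0 < ε) (hq : 9 * C₂ * b * ε < 1) (hRC : 3 * ε ≤ R) :
    ∃ Dt : (β → X) → (C → X), Eq17Local ℂ b₀ (fun c => ⇑(h c)) Ct ε (4 * C₂ * ε ^ 2) Dt ∧
      ∀ A : β → X, ‖A‖ < ε → ∀ D : C → X, ‖hOpLin b₀ h D‖ < ε →
        Function.IsFixedPt (fpMap b₀ (fun c => ⇑(h c)) Ct A) D → D = Dt A :=
  exists_solution b₀ h hC (analyticOnNhd_of_quadAnalytic hC) hC₂ hb hh hε hq hRC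

variable {d n m : ℕ} [NeZero m] [NeZero n] {ι : Type*} [Fintype ι] [DecidableEq ι]

/-- **p. 260 (17) + «depends on A restricted to B(c₋) ∪ B(c₊)» + (20) p. 261 on the torus over `ℂ`, binders =
print's data `(C̃, h)` only — §2 `exists_local_solution_torus` WITHOUT the analyticity binder `hCa`** (supplied by
`B13QuadAnalyticFrechet.analyticOnNhd_of_quadAnalytic hC`).  Coordinates `X = ι → ℂ` of `𝔤ᶜ`; fine lattice
`(ℤ/n)ᵈ`, coarse `(ℤ/m)ᵈ`, `n = L·m`, block offset `h < L`, `2 < m`; `C̃` with `QuadAnalytic C̃ C₂ R` and local on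
`B(c₋) ∪ B(c₊)`; `h(c)` linear with `‖h c x‖ ≤ b‖x‖`; `0 < ε`, `9C₂bε < 1`, `3ε ≤ R`.  Conclusion: `Dt` with
(i) `Eq17Local ℂ b₀ h C̃ ε (4C₂ε²) Dt`, (ii) the dependence property on the ball, (iii) (20) with THE Fréchet
derivative at every `‖A‖ < ε`. [cite: Balaban1985UV3, (17)-(20) pp.260-261] -/
theorem exists_local_solution_torus_of_quadAnalytic (L h : ℕ) (hn : n = L * m) (hh : h < L) (hm : 2 < m)
    (hop : Bond (Fin d → ZMod m) d → (ι → ℂ) →ₗ[ℂ] (ι → ℂ))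
    {Ct : (Bond (Fin d → ZMod n) d → ι → ℂ) → Bond (Fin d → ZMod m) d → (ι → ℂ)} {C₂ R b ε : ℝ}
    (hC : QuadAnalytic Ct C₂ R) (hC₂ : 0 ≤ C₂) (hb : 0 ≤ b)
    (hhb : ∀ c x, ‖hop c x‖ ≤ b * ‖x‖) (hε : 0 < ε) (hq : 9 * C₂ * b * ε < 1) (hRC : 3 * ε ≤ R)
    (hCt : ∀ A A' c, (∀ b ∈ depSet (blk (n := n) L m h) (fUnit n) (cUnit m) c, A b = A' b) → Ct A c = Ct A' c) :
    ∃ Dt : (Bond (Fin d → ZMod n) d → ι → ℂ) → Bond (Fin d → ZMod m) d → (ι → ℂ),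
      Eq17Local ℂ (b0 L n h) (fun c => ⇑(hop c)) Ct ε (4 * C₂ * ε ^ 2) Dt ∧
      (∀ B B' : Bond (Fin d → ZMod n) d → ι → ℂ, ‖B‖ < ε → ‖B'‖ < ε → ∀ c : Bond (Fin d → ZMod m) d,
        (∀ b ∈ depSet (blk (n := n) L m h) (fUnit n) (cUnit m) c, B b = B' b) → Dt B c = Dt B' c) ∧
      ∀ A : Bond (Fin d → ZMod n) d → ι → ℂ, ‖A‖ < ε →
        LinearMap.det (LinearMap.id -
            (fderiv ℂ (fun A => hOp (b0 L n h) (fun c => ⇑(hop c)) (Dt A)) A :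
              (Bond (Fin d → ZMod n) d → ι → ℂ) →ₗ[ℂ] (Bond (Fin d → ZMod n) d → ι → ℂ)))
          = ∏ c, (1 - coarseBlock (b0 (m := m) L n h)
              (jac (fderiv ℂ (fun A => hOp (b0 L n h) (fun c => ⇑(hop c)) (Dt A)) A :
                (Bond (Fin d → ZMod n) d → ι → ℂ) →ₗ[ℂ] (Bond (Fin d → ZMod n) d → ι → ℂ))) c).det :=
  exists_local_solution_torus L h hn hh hm hop hC (analyticOnNhd_of_quadAnalytic hC) hC₂ hb hhb hε hq hRC hCt

/-- **«for A sufficiently small» on the torus, radius chosen**: for `C̃` with `QuadAnalytic C̃ C₂ R`, `R > 0`, local on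
`B(c₋) ∪ B(c₊)`, and bounded linear `h(c)`, there are `ε > 0` and `Dt` with the three conclusions of
`exists_local_solution_torus_of_quadAnalytic` on the ball `‖A‖ < ε` (`ε = min(R/3, (9C₂b + 1)⁻¹)` as in
`B10Eq17LocalSolution.exists_radius_eq17Local`). [cite: Balaban1985UV3, (17)-(20) pp.260-261] -/
theorem exists_radius_local_solution_torus (L h : ℕ) (hn : n = L * m) (hh : h < L) (hm : 2 < m)
    (hop : Bond (Fin d → ZMod m) d → (ι → ℂ) →ₗ[ℂ] (ι → ℂ))
    {Ct : (Bond (Fin d → ZMod n) d → ι → ℂ) → Bond (Fin d → ZMod m) d → (ι → ℂ)} {C₂ R b : ℝ}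
    (hC : QuadAnalytic Ct C₂ R) (hC₂ : 0 ≤ C₂) (hb : 0 ≤ b) (hhb : ∀ c x, ‖hop c x‖ ≤ b * ‖x‖) (hR : 0 < R)
    (hCt : ∀ A A' c, (∀ b ∈ depSet (blk (n := n) L m h) (fUnit n) (cUnit m) c, A b = A' b) → Ct A c = Ct A' c) :
    ∃ ε : ℝ, 0 < ε ∧ ∃ Dt : (Bond (Fin d → ZMod n) d → ι → ℂ) → Bond (Fin d → ZMod m) d → (ι → ℂ),
      Eq17Local ℂ (b0 L n h) (fun c => ⇑(hop c)) Ct ε (4 * C₂ * ε ^ 2) Dt ∧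
      (∀ B B' : Bond (Fin d → ZMod n) d → ι → ℂ, ‖B‖ < ε → ‖B'‖ < ε → ∀ c : Bond (Fin d → ZMod m) d,
        (∀ b ∈ depSet (blk (n := n) L m h) (fUnit n) (cUnit m) c, B b = B' b) → Dt B c = Dt B' c) ∧
      ∀ A : Bond (Fin d → ZMod n) d → ι → ℂ, ‖A‖ < ε →
        LinearMap.det (LinearMap.id -
            (fderiv ℂ (fun A => hOp (b0 L n h) (fun c => ⇑(hop c)) (Dt A)) A :
              (Bond (Fin d → ZMod n) d → ι → ℂ) →ₗ[ℂ] (Bond (Fin d → ZMod n) d → ι → ℂ)))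
          = ∏ c, (1 - coarseBlock (b0 (m := m) L n h)
              (jac (fderiv ℂ (fun A => hOp (b0 L n h) (fun c => ⇑(hop c)) (Dt A)) A :
                (Bond (Fin d → ZMod n) d → ι → ℂ) →ₗ[ℂ] (Bond (Fin d → ZMod n) d → ι → ℂ))) c).det := by
  set ε : ℝ := min (R / 3) (9 * C₂ * b + 1)⁻¹ with hεdef
  have hpos : 0 < 9 * C₂ * b + 1 := by positivity
  have hε : 0 < ε := lt_min (by positivity) (inv_pos.mpr hpos)
  have hRC : 3 * ε ≤ R := by
    have : ε ≤ R / 3 := min_le_left _ _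
    linarith
  have hq : 9 * C₂ * b * ε < 1 := by
    have h1 : ε ≤ (9 * C₂ * b + 1)⁻¹ := min_le_right _ _
    have h2 : 9 * C₂ * b * ε ≤ 9 * C₂ * b * (9 * C₂ * b + 1)⁻¹ :=
      mul_le_mul_of_nonneg_left h1 (by positivity)
    have h3 : 9 * C₂ * b * (9 * C₂ * b + 1)⁻¹ < 1 := by
      rw [← div_eq_mul_inv, div_lt_one hpos]
      linarith
    exact h2.trans_lt h3
  exact ⟨ε, hε, exists_local_solution_torus_of_quadAnalytic L h hn hh hm hop hC hC₂ hb hhb hε hq hRC hCt⟩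

end QuadAnalyticOnly

/-! ## §4  (v1.2) The p. 260 paragraph end to end on the torus over `ℝ` WITH print's uniqueness clause
(`B10Eq17LocalSolution` §7 `exists_solution_real`, p303399) -/

section RealUnique

variable {d n m : ℕ} [NeZero m] [NeZero n] {ι : Type*} [Fintype ι] [DecidableEq ι]

/-- **p. 260 (17) «There exists a unique solution D̃ … for A sufficiently small» + «depends on A restricted to
B(c₋) ∪ B(c₊)» + (20) p. 261, on the torus over `ℝ` (print's own setting), WITH THE UNIQUENESS CLAUSE in print's
solution space** ([7] p. 286: «exactly one fixed point … It satisfies the bound |D(A′)| < ε₃/B₀»).  Data as in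
`exists_local_solution_torus_real` (`C̃` real-analytic on `‖Y‖ < R`, `C̃(0) = 0`, `DC̃(0) = 0`, local on `B(c₋) ∪ B(c₊)`;
`h(c)` linear with `‖h c x‖ ≤ b‖x‖`; fine torus `(ℤ/n)ᵈ`, coarse `(ℤ/m)ᵈ`, `n = L·m`, offset `h < L`, `2 < m`).
Conclusion: radii `r, δ > 0` and `Dt` with (i) `Eq17Local ℝ b₀ h C̃ r δ Dt`; (ii) `‖hD̃(A)‖ < 3r` for `‖A‖ < r` and
`D̃(A)` is the ONLY fixed point `D` of `D ↦ C̃(A − hD)` with `‖hD‖ < 3r`; (iii) the dependence property on the ball;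
(iv) (20) with the actual derivative.  Knit of `B10Eq17LocalSolution.exists_solution_real` with §1.
[cite: Balaban1985UV3, (17)-(20) pp.260-261] -/
theorem exists_local_solution_torus_real_unique (L h : ℕ) (hn : n = L * m) (hh : h < L) (hm : 2 < m)
    (hop : Bond (Fin d → ZMod m) d → (ι → ℝ) →ₗ[ℝ] (ι → ℝ))
    {Ct : (Bond (Fin d → ZMod n) d → ι → ℝ) → Bond (Fin d → ZMod m) d → (ι → ℝ)} {R b : ℝ}
    (hR : 0 < R) (hCω : ContDiffOn ℝ ω Ct (ball 0 R)) (hC0 : Ct 0 = 0) (hDC0 : fderiv ℝ Ct 0 = 0)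
    (hb : 0 ≤ b) (hhb : ∀ c x, ‖hop c x‖ ≤ b * ‖x‖)
    (hCt : ∀ A A' c, (∀ b ∈ depSet (blk (n := n) L m h) (fUnit n) (cUnit m) c, A b = A' b) → Ct A c = Ct A' c) :
    ∃ r δ : ℝ, 0 < r ∧ 0 < δ ∧ ∃ Dt : (Bond (Fin d → ZMod n) d → ι → ℝ) → Bond (Fin d → ZMod m) d → (ι → ℝ),
      Eq17Local ℝ (b0 L n h) (fun c => ⇑(hop c)) Ct r δ Dt ∧
      (∀ A : Bond (Fin d → ZMod n) d → ι → ℝ, ‖A‖ < r →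
        ‖hOp (b0 L n h) (fun c => ⇑(hop c)) (Dt A)‖ < 3 * r ∧
        ∀ D : Bond (Fin d → ZMod m) d → (ι → ℝ), ‖hOp (b0 L n h) (fun c => ⇑(hop c)) D‖ < 3 * r →
          Function.IsFixedPt (fpMap (b0 L n h) (fun c => ⇑(hop c)) Ct A) D → D = Dt A) ∧
      (∀ B B' : Bond (Fin d → ZMod n) d → ι → ℝ, ‖B‖ < r → ‖B'‖ < r → ∀ c : Bond (Fin d → ZMod m) d,
        (∀ b ∈ depSet (blk (n := n) L m h) (fUnit n) (cUnit m) c, B b = B' b) → Dt B c = Dt B' c) ∧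
      ∀ A : Bond (Fin d → ZMod n) d → ι → ℝ, ‖A‖ < r →
        LinearMap.det (LinearMap.id -
            (fderiv ℝ (fun A => hOp (b0 L n h) (fun c => ⇑(hop c)) (Dt A)) A :
              (Bond (Fin d → ZMod n) d → ι → ℝ) →ₗ[ℝ] (Bond (Fin d → ZMod n) d → ι → ℝ)))
          = ∏ c, (1 - coarseBlock (b0 (m := m) L n h)
              (jac (fderiv ℝ (fun A => hOp (b0 L n h) (fun c => ⇑(hop c)) (Dt A)) A :
                (Bond (Fin d → ZMod n) d → ι → ℝ) →ₗ[ℝ] (Bond (Fin d → ZMod n) d → ι → ℝ))) c).det := by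
  obtain ⟨r, δ, hr, hδ, Dt, h17, hin, huniq⟩ := exists_solution_real (b0 L n h) hop hR hCω hC0 hDC0 hb hhb
  refine ⟨r, δ, hr, hδ, Dt, h17, fun A hA => ⟨?_, fun D hD hfixD => ?_⟩,
    fun B B' hB hB' c hBB' => apply_eq_of_eqOn_torus L h hn hh hm hCt h17 hB hB' hBB',
    fun A hA => eq20_fderiv_torus L h hn hh hm hCt hb hhb h17 hA⟩
  · simpa only [hOpLin_apply] using hin A hA
  · exact huniq A hA D (by simpa only [hOpLin_apply] using hD) hfixD

omit [DecidableEq ι] in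
/-- **«exactly one» on the torus over `ℝ`**: for some `r > 0` and every `‖A‖ < r` there is EXACTLY ONE `D` with
`‖hD‖ < 3r` solving `D = C̃(A − hD)` (data as in `exists_local_solution_torus_real_unique`).
[cite: Balaban1985UV3, (17) pp.259–260] -/
theorem existsUnique_local_solution_torus_real (L h : ℕ)
    (hop : Bond (Fin d → ZMod m) d → (ι → ℝ) →ₗ[ℝ] (ι → ℝ))
    {Ct : (Bond (Fin d → ZMod n) d → ι → ℝ) → Bond (Fin d → ZMod m) d → (ι → ℝ)} {R b : ℝ}
    (hR : 0 < R) (hCω : ContDiffOn ℝ ω Ct (ball 0 R)) (hC0 : Ct 0 = 0) (hDC0 : fderiv ℝ Ct 0 = 0)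
    (hb : 0 ≤ b) (hhb : ∀ c x, ‖hop c x‖ ≤ b * ‖x‖) :
    ∃ r : ℝ, 0 < r ∧ ∀ A : Bond (Fin d → ZMod n) d → ι → ℝ, ‖A‖ < r →
      ∃! D : Bond (Fin d → ZMod m) d → (ι → ℝ), ‖hOp (b0 L n h) (fun c => ⇑(hop c)) D‖ < 3 * r ∧
        Function.IsFixedPt (fpMap (b0 L n h) (fun c => ⇑(hop c)) Ct A) D := by
  obtain ⟨r, hr, hA⟩ := existsUnique_solution_real (b0 L n h) hop hR hCω hC0 hDC0 hb hhb
  refine ⟨r, hr, fun A hAr => ?_⟩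
  simpa only [hOpLin_apply] using hA A hAr

end RealUnique

end Literature.MathematicalPhysics.QuantumFieldTheory.Balaban1983to89.B10Eq17LocalTorus
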